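import Summits.QuantumFields.BalabanUV.Beta.SymCorrectorPairGauge
import Summits.QuantumFields.BalabanUV.Beta.SecondOrderRemainderTables

/-!
# `BalabanUV.Beta.SymCorrectorPairGaugeVertex` — binder row D1, road «BF-x» junction (J1), brick TT12: **THE BI-VERTEX OF THE DOUBLY TRANSPORTED BI-STENCIL
# IS THE RAW BI-VERTEX PLUS THE OWNER's `Wmix`-PIECES AND `Wgg`-PIECE** — the (W-pair) word of the chart transport (TT4 `SymCorrectorPair.vertex2OfK_conj_psiKS`)
# written as second-order gauge letters of `D1BFx/ColumnGaugeInvariance.hessKer_columnGauge`, through ANY spread kernel (sequel of TT11 `SymCorrectorPairGauge`)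

THE MATHEMATICS.  TT11 writes the doubly slot-transported bi-stencil, under the rooted slot Ward letters `hL` (first slot, partner `T′`), `hR` (second slot, partner `T`)
and the first-order letter `hT` of `T′` against `𝕄`, as `S₂ + conjV (T′ ·) θ₁ + conjV (T ·) θ₂ + conjV (conjV 𝕄 θ₃) θ₁` with block contacts `θᵢ`.  Here the pieces are
read through the chain-rule bi-vertex `vertex2OfK K n` of an2's `SecondOrderResponse`:
* §1 LETTER-FREE bi-vertices of the three contact families through ANY `K` (TT10 `vertexOfK_blockContact_eq_conjV` + TT11 `vertexOfK_conjV_diagK_fixed`; no summability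
  hypothesis — every site series is finitely supported or closes by `tsum_mul_right`):
  `vertex2OfK K n (α x κ′ u′ ↦ conjV (T′ κ′ u′) (θ α x)) μ y ν y′ = conjV (vertexOfK K n T′ ν y′) (Θ μ y)` (the `[Λ, V′]` letter),
  `vertex2OfK K n (α x κ′ u′ ↦ conjV (T α x) (θ′ κ′ u′)) μ y ν y′ = conjV (vertexOfK K n T μ y) (Θ′ ν y′)` (the `[Λ′, V]` letter),
  `vertex2OfK K n (α x κ′ u′ ↦ conjV (conjV 𝕄 (θ′ κ′ u′)) (θ α x)) μ y ν y′ = conjV (conjV 𝕄 (Θ′ ν y′)) (Θ μ y)` (the `[Λ, G′]` letter),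
  `Θ μ y := diagK (z b ↦ Σ_α Σ_{x ∈ blockSitesF n (blk n (legSite ρ z b))} colH K n μ y α x·c α x)` — TT10's dressed block symbol (block-constant in the leg's site);
* §2 entrywise bounds of the pieces (`abs_conjV_diagK_le`, `abs_blockCoeff_le`) — the sockets of an2's `SecondOrderRemainderTables.vertex2OfK_add_of_bdd`;
* §3 ASSEMBLED, for a spread `K`, a local bi-stencil family `LocStencil₂ S₂ C₂ δ₂`, entrywise bounded partners `T`, `T′`, `𝕄` and the three letters:
  **`vertex2OfK K n (α x ↦ slotPsiS r n (slotPsiS r n S₂ α x)) μ y ν y′ = vertex2OfK K n S₂ μ y ν y′ + conjV (vertexOfK K n T′ ν y′) (Θ₁ μ y) + conjV (vertexOfK K n T μ y) (Θ₂ ν y′)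
  + conjV (conjV 𝕄 (Θ₃ ν y′)) (Θ₁ μ y)`**, and, with TT4, **the same for `vertex2OfK (Ψ̂∘K∘Ψ̂ᵀ) n S₂ μ y ν y′`** (`Ψ̂ := psiKS r n`, in-block root offset) — with `T = T′ = S` and
  `Λ := −Θ` the three extra terms are `Wmix μ y ν y′ + Wgg μ y ν y′` of `hessKer_columnGauge` (TT11 §3 `mixed_eq_Wmix`, `faceFace_eq_Wgg`).
The `mixOfK` ∕ `dM∘K2OfK` words of the transported `W2OfK` (TT6∕TT8's (D-R) rest) are NOT in this file.

HONEST DEPENDENCY (cell records, verbatim): «continuum YM on T⁴ ⇐ BetaPertH ∧ nine spine estimates (0/9 proved); BetaPertH ⇐ (D1) ∧ (D4) ∧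
CAP+tail; G-an2-4 gates asym, D1 and NE2/3/4.»  HONEST FRAMING (cell contract, verbatim): «discharging `BetaPertH` makes Bałaban's UV stability
UNCONDITIONAL — a real constructive-QFT result; it is NOT the continuum limit and NOT the Clay problem.»  THIS MODULE DISCHARGES NOTHING of (K), of
(J1)'s row, of D1 or of the wall: [folklore] identities between OUR kernels BY NAME; the three letters are HYPOTHESES (no table's letter is proved here).
No definition, no `def … : Prop`, nothing cited, 0 sorry.  0∕4 row-D1 binders; (K) NOT closed; (J1) = ONE OPEN ROW; NOT D1, NEVER «G-an2-4 closed»,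
NOT `BetaPertH`, NOT continuum, NOT Clay.

ABSOLUTE RULE (cell charter, verbatim): «No internally-minted statement may enter as a cited fact. Every hypothesis is either kernel-proved in this
package or a verbatim quotation of a PUBLISHED theorem with page reference. The manuscript(s) under audit are NOT citable for their own disputed
steps — they are the thing under adjudication; programme-internal (2001/route/tribunal) claims are never citable.»

D1 formalisation swarm LEAF 03 (`b2b-balaban-beta-d1-formalise-leaf-03`, gen 30), 2026-08-23; over TT10∕TT11 (leaf-03), TT4 `SymCorrectorPair`, an2's
`SecondOrderRemainderTables` ∕ `DiagonalContact`, an3's `VertexReflectionContact` BY NAME; no existing file touched.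
-/

open Finset
open scoped BigOperators
open Literature.MathematicalPhysics.QuantumFieldTheory
open Literature.MathematicalPhysics.QuantumFieldTheory.Balaban1983to89
open Literature.MathematicalPhysics.QuantumFieldTheory.Balaban1983to89.Beta
open B12Sec2to5 (l1 l1_nonneg)
open ExpKernelCalculus (MKer Decays comp)
open OneStepResolventKernel (Fib wsum)
open OneStepKernelFamily (colH vertexOfK)
open SecondOrderResponse (vertex2OfK)
open BalabanCompositeJets (LocStencil₂)
open KernelWard (divV)
open AffineAveraging (Site box)
open AveragingContours (blk)
open Summit.QuantumFields.BalabanUV.Beta.TameKernelCalculus (Spr trK)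
open Summit.QuantumFields.BalabanUV.Beta.ChartConjugation (conjV)
open Summit.QuantumFields.BalabanUV.Beta.BorderedHessian (diagK diagK_apply conjV_diagK_apply)
open Summit.QuantumFields.BalabanUV.Beta.AveragingWardRootedStencils (legSite legInd)
open Summit.QuantumFields.BalabanUV.Beta.CompositeCorrectorLocality (blockSitesF)
open Summit.QuantumFields.BalabanUV.Beta.SymCorrectorKernel (psiKS)
open Summit.QuantumFields.BalabanUV.Beta.SymCorrectorFace (faceWt faceWtSum faceWtSum_nonneg abs_faceWt_le faceSum slotPsiS)
open Summit.QuantumFields.BalabanUV.Beta.SymCorrectorPair (vertex2OfK_conj_psiKS abs_slice_le)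
open Summit.QuantumFields.BalabanUV.Beta.SecondOrderRemainderTables (vertex2OfK_add_of_bdd)
open Summit.QuantumFields.BalabanUV.Beta.SymCorrectorFaceGauge (vertexOfK_blockContact_eq_conjV)
open Summit.QuantumFields.BalabanUV.Beta.SymCorrectorPairGauge (vertexOfK_conjV_diagK_fixed slotPsiS₂_eq_add_contacts_of_letters')

namespace Summit.QuantumFields.BalabanUV.Beta.SymCorrectorPairGaugeVertex

noncomputable section

variable {d : ℕ} {n : ℕ}

/-! ## §1 Letter-free: the bi-vertices of the three contact families through any `K` -/

section BiVertex

variable (hn : 0 < n) (K : MKer (d + 1) (Fib d)) (ρ : Site (d + 1))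
include hn

/-- [folklore] **MIXED, OUTER-INDEXED**: `vertex2OfK K n (α x κ′ u′ ↦ conjV (T′ κ′ u′) (θ α x)) μ y ν y′ = conjV (vertexOfK K n T′ ν y′) (Θ μ y)`,
`θ α x := diagK (z b ↦ [blk n (legSite ρ z b) = blk n x]·c α x)`, `Θ μ y := diagK (z b ↦ Σ_α Σ_{x ∈ blockSitesF n (blk n (legSite ρ z b))} colH K n μ y α x·c α x)` —
the `[Θ, V′]` letter (inner: §1 fixed generator; outer: TT10's block contact through the column). -/
theorem vertex2OfK_outerContact_eq (T' : Fin (d + 1) → Site (d + 1) → MKer (d + 1) (Fib d)) (c : Fin (d + 1) → Site (d + 1) → ℝ)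
    (μ : Fin (d + 1)) (y : Site (d + 1)) (ν : Fin (d + 1)) (y' : Site (d + 1)) :
    vertex2OfK K n (fun α x κ' u' => conjV (T' κ' u') (diagK fun z b => if blk n (legSite ρ z b) = blk n x then c α x else 0)) μ y ν y'
      = conjV (vertexOfK K n T' ν y') (diagK fun z b => ∑ α : Fin (d + 1), ∑ x ∈ blockSitesF n (blk n (legSite ρ z b)), colH K n μ y α x * c α x) := by
  unfold SecondOrderResponse.vertex2OfK
  have hin : (fun α x => vertexOfK K n (fun κ' u' => conjV (T' κ' u') (diagK fun z b => if blk n (legSite ρ z b) = blk n x then c α x else 0)) ν y')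
      = fun α x => conjV (vertexOfK K n T' ν y') (diagK fun z b => if blk n (legSite ρ z b) = blk n x then c α x else 0) := by
    funext α x
    exact vertexOfK_conjV_diagK_fixed K T' _ ν y'
  rw [hin]
  exact vertexOfK_blockContact_eq_conjV hn K (vertexOfK K n T' ν y') ρ c μ y

/-- [folklore] **MIXED, INNER-INDEXED**: `vertex2OfK K n (α x κ′ u′ ↦ conjV (T α x) (θ′ κ′ u′)) μ y ν y′ = conjV (vertexOfK K n T μ y) (Θ′ ν y′)` — the `[Θ′, V]` letter. -/
theorem vertex2OfK_innerContact_eq (T : Fin (d + 1) → Site (d + 1) → MKer (d + 1) (Fib d)) (c' : Fin (d + 1) → Site (d + 1) → ℝ)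
    (μ : Fin (d + 1)) (y : Site (d + 1)) (ν : Fin (d + 1)) (y' : Site (d + 1)) :
    vertex2OfK K n (fun α x κ' u' => conjV (T α x) (diagK fun z b => if blk n (legSite ρ z b) = blk n u' then c' κ' u' else 0)) μ y ν y'
      = conjV (vertexOfK K n T μ y) (diagK fun z b => ∑ κ' : Fin (d + 1), ∑ u' ∈ blockSitesF n (blk n (legSite ρ z b)), colH K n ν y' κ' u' * c' κ' u') := by
  unfold SecondOrderResponse.vertex2OfK
  have hin : (fun α x => vertexOfK K n (fun κ' u' => conjV (T α x) (diagK fun z b => if blk n (legSite ρ z b) = blk n u' then c' κ' u' else 0)) ν y')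
      = fun α x => conjV (T α x) (diagK fun z b => ∑ κ' : Fin (d + 1), ∑ u' ∈ blockSitesF n (blk n (legSite ρ z b)), colH K n ν y' κ' u' * c' κ' u') := by
    funext α x
    exact vertexOfK_blockContact_eq_conjV hn K (T α x) ρ c' ν y'
  rw [hin]
  exact vertexOfK_conjV_diagK_fixed K T _ μ y

/-- [folklore] **FACE × FACE**: `vertex2OfK K n (α x κ′ u′ ↦ conjV (conjV 𝕄 (θ′ κ′ u′)) (θ α x)) μ y ν y′ = conjV (conjV 𝕄 (Θ′ ν y′)) (Θ μ y)` — the `[[𝕄, Θ′], Θ]` letter. -/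
theorem vertex2OfK_faceFaceContact_eq (𝕄 : MKer (d + 1) (Fib d)) (c c' : Fin (d + 1) → Site (d + 1) → ℝ)
    (μ : Fin (d + 1)) (y : Site (d + 1)) (ν : Fin (d + 1)) (y' : Site (d + 1)) :
    vertex2OfK K n (fun α x κ' u' => conjV (conjV 𝕄 (diagK fun z b => if blk n (legSite ρ z b) = blk n u' then c' κ' u' else 0))
        (diagK fun z b => if blk n (legSite ρ z b) = blk n x then c α x else 0)) μ y ν y'
      = conjV (conjV 𝕄 (diagK fun z b => ∑ κ' : Fin (d + 1), ∑ u' ∈ blockSitesF n (blk n (legSite ρ z b)), colH K n ν y' κ' u' * c' κ' u'))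
          (diagK fun z b => ∑ α : Fin (d + 1), ∑ x ∈ blockSitesF n (blk n (legSite ρ z b)), colH K n μ y α x * c α x) := by
  unfold SecondOrderResponse.vertex2OfK
  have hin : (fun α x => vertexOfK K n (fun κ' u' => conjV (conjV 𝕄 (diagK fun z b => if blk n (legSite ρ z b) = blk n u' then c' κ' u' else 0))
        (diagK fun z b => if blk n (legSite ρ z b) = blk n x then c α x else 0)) ν y')
      = fun α x => conjV (conjV 𝕄 (diagK fun z b => ∑ κ' : Fin (d + 1), ∑ u' ∈ blockSitesF n (blk n (legSite ρ z b)), colH K n ν y' κ' u' * c' κ' u'))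
          (diagK fun z b => if blk n (legSite ρ z b) = blk n x then c α x else 0) := by
    funext α x
    rw [vertexOfK_conjV_diagK_fixed K _ _ ν y', vertexOfK_blockContact_eq_conjV hn K 𝕄 ρ c' ν y']
  rw [hin]
  exact vertexOfK_blockContact_eq_conjV hn K _ ρ c μ y

end BiVertex

/-! ## §2 Entrywise bounds (sockets of `vertex2OfK_add_of_bdd`); §3 the assembled bi-vertex -/

section Bounds

/-- [folklore] An entrywise bound for a diagonal contact: `|A| ≤ B_A`, `|g| ≤ B_g` ⟹ `|conjV A (diagK g) p q a c| ≤ B_A·(2·B_g)`. -/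
theorem abs_conjV_diagK_le {A : MKer (d + 1) (Fib d)} {BA : ℝ} (hA : ∀ p q a c, |A p q a c| ≤ BA) {g : Site (d + 1) → Fib d → ℝ} {Bg : ℝ}
    (hg : ∀ z b, |g z b| ≤ Bg) (p q : Site (d + 1)) (a c : Fib d) : |conjV A (diagK g) p q a c| ≤ BA * (2 * Bg) := by
  rw [conjV_diagK_apply, abs_mul]
  have hBA : 0 ≤ BA := (abs_nonneg _).trans (hA p q a c)
  refine mul_le_mul (hA p q a c) ?_ (abs_nonneg _) hBA
  calc |g q c - g p a| ≤ |g q c| + |g p a| := abs_sub _ _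
    _ ≤ Bg + Bg := add_le_add (hg q c) (hg p a)
    _ = 2 * Bg := by ring

/-- [folklore] The block-contact coefficient of a face piece is bounded by `|ξ|·faceWtSum r n`. -/
theorem abs_blockCoeff_le (hn : 0 < n) (r : Fin (d + 1) → ℕ) (ρ : Site (d + 1)) (ξ : ℝ) (β : Fin (d + 1)) (w z : Site (d + 1)) (b : Fib d) :
    |(if blk n (legSite ρ z b) = blk n w then ξ * faceWt r n β w else 0)| ≤ |ξ| * faceWtSum r n := by
  split_ifs
  · rw [abs_mul]; exact mul_le_mul_of_nonneg_left (abs_faceWt_le hn r β w) (abs_nonneg ξ)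
  · rw [abs_zero]; exact mul_nonneg (abs_nonneg ξ) (faceWtSum_nonneg r n)

end Bounds

section Assembled

variable (hn : 0 < n) (r : Fin (d + 1) → ℕ) {K : MKer (d + 1) (Fib d)} (hK : Spr K)
  {S₂ : Fin (d + 1) → Site (d + 1) → Fin (d + 1) → Site (d + 1) → MKer (d + 1) (Fib d)} {C₂ δ₂ : ℝ} (hS₂ : LocStencil₂ S₂ C₂ δ₂) (hδ₂ : 0 < δ₂)
  {T T' : Fin (d + 1) → Site (d + 1) → MKer (d + 1) (Fib d)} {BT : ℝ} (hTb : ∀ κ u p q a c, |T κ u p q a c| ≤ BT) (hT'b : ∀ κ u p q a c, |T' κ u p q a c| ≤ BT)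
  {𝕄 : MKer (d + 1) (Fib d)} {BM : ℝ} (hMb : ∀ p q a c, |𝕄 p q a c| ≤ BM)
  {ρ : Site (d + 1)} {ξ₁ ξ₂ ξ₃ : ℝ}
  (hL : ∀ κ' u' u, divV (fun κ u => S₂ κ u κ' u') u = ξ₁ • conjV (T' κ' u') (diagK (legInd ρ u)))
  (hR : ∀ α x u', divV (S₂ α x) u' = ξ₂ • conjV (T α x) (diagK (legInd ρ u')))
  (hT : ∀ u', divV T' u' = ξ₃ • conjV 𝕄 (diagK (legInd ρ u')))
include hn hK hS₂ hδ₂ hTb hT'b hMb hL hR hT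

/-- [folklore] **THE BI-VERTEX OF THE DOUBLY TRANSPORTED BI-STENCIL, ASSEMBLED**: for a spread `K`, a local bi-stencil family, entrywise bounded partners and the three
letters, at every pair of coarse bonds
`vertex2OfK K n (α x ↦ slotPsiS r n (slotPsiS r n S₂ α x)) μ y ν y′ = vertex2OfK K n S₂ μ y ν y′ + conjV (vertexOfK K n T′ ν y′) (Θ₁ μ y) + conjV (vertexOfK K n T μ y) (Θ₂ ν y′)
 + conjV (conjV 𝕄 (Θ₃ ν y′)) (Θ₁ μ y)`, `Θᵢ μ y := diagK (z b ↦ Σ_α Σ_{x ∈ blockSitesF n (blk n (legSite ρ z b))} colH K n μ y α x·(ξᵢ·faceWt r n α x))`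
(TT11 §2 + additivity `vertex2OfK_add_of_bdd` on entrywise bounded pieces + §1). -/
theorem vertex2OfK_slotPsiS₂_eq_add_contacts_of_letters (μ : Fin (d + 1)) (y : Site (d + 1)) (ν : Fin (d + 1)) (y' : Site (d + 1)) :
    vertex2OfK K n (fun α x => slotPsiS r n (slotPsiS r n S₂ α x)) μ y ν y'
      = vertex2OfK K n S₂ μ y ν y'
        + conjV (vertexOfK K n T' ν y')
            (diagK fun z b => ∑ α : Fin (d + 1), ∑ x ∈ blockSitesF n (blk n (legSite ρ z b)), colH K n μ y α x * (ξ₁ * faceWt r n α x))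
        + conjV (vertexOfK K n T μ y)
            (diagK fun z b => ∑ κ' : Fin (d + 1), ∑ u' ∈ blockSitesF n (blk n (legSite ρ z b)), colH K n ν y' κ' u' * (ξ₂ * faceWt r n κ' u'))
        + conjV (conjV 𝕄 (diagK fun z b => ∑ κ' : Fin (d + 1), ∑ u' ∈ blockSitesF n (blk n (legSite ρ z b)), colH K n ν y' κ' u' * (ξ₃ * faceWt r n κ' u')))
            (diagK fun z b => ∑ α : Fin (d + 1), ∑ x ∈ blockSitesF n (blk n (legSite ρ z b)), colH K n μ y α x * (ξ₁ * faceWt r n α x)) := by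
  obtain ⟨CK, δK, hδK, hKd⟩ := hK
  have hKex : ∃ δ C : ℝ, 0 < δ ∧ 0 ≤ C ∧ Decays K C δ := ⟨δK, CK, hδK, hKd.nonneg (Sum.inl 0), hKd⟩
  -- entrywise bounds of the four pieces
  have hc1 : ∀ β w z b, |(if blk n (legSite ρ z b) = blk n w then ξ₁ * faceWt r n β w else 0)| ≤ |ξ₁| * faceWtSum r n :=
    fun β w z b => abs_blockCoeff_le hn r ρ ξ₁ β w z b
  have hc2 : ∀ β w z b, |(if blk n (legSite ρ z b) = blk n w then ξ₂ * faceWt r n β w else 0)| ≤ |ξ₂| * faceWtSum r n :=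
    fun β w z b => abs_blockCoeff_le hn r ρ ξ₂ β w z b
  have hc3 : ∀ β w z b, |(if blk n (legSite ρ z b) = blk n w then ξ₃ * faceWt r n β w else 0)| ≤ |ξ₃| * faceWtSum r n :=
    fun β w z b => abs_blockCoeff_le hn r ρ ξ₃ β w z b
  have b1 : ∀ α x κ' u' p q a c, |S₂ α x κ' u' p q a c| ≤ C₂ := fun α x κ' u' p q a c => abs_slice_le hS₂ hδ₂.le α x κ' u' p q a c
  have b2 : ∀ (α : Fin (d + 1)) (x : Site (d + 1)) (κ' : Fin (d + 1)) (u' p q : Site (d + 1)) (a c : Fib d),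
      |conjV (T' κ' u') (diagK fun z b => if blk n (legSite ρ z b) = blk n x then ξ₁ * faceWt r n α x else 0) p q a c| ≤ BT * (2 * (|ξ₁| * faceWtSum r n)) :=
    fun α x κ' u' p q a c => abs_conjV_diagK_le (hT'b κ' u') (hc1 α x) p q a c
  have b3 : ∀ (α : Fin (d + 1)) (x : Site (d + 1)) (κ' : Fin (d + 1)) (u' p q : Site (d + 1)) (a c : Fib d),
      |conjV (T α x) (diagK fun z b => if blk n (legSite ρ z b) = blk n u' then ξ₂ * faceWt r n κ' u' else 0) p q a c| ≤ BT * (2 * (|ξ₂| * faceWtSum r n)) :=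
    fun α x κ' u' p q a c => abs_conjV_diagK_le (hTb α x) (hc2 κ' u') p q a c
  have b4 : ∀ (α : Fin (d + 1)) (x : Site (d + 1)) (κ' : Fin (d + 1)) (u' p q : Site (d + 1)) (a c : Fib d),
      |conjV (conjV 𝕄 (diagK fun z b => if blk n (legSite ρ z b) = blk n u' then ξ₃ * faceWt r n κ' u' else 0))
          (diagK fun z b => if blk n (legSite ρ z b) = blk n x then ξ₁ * faceWt r n α x else 0) p q a c|
        ≤ BM * (2 * (|ξ₃| * faceWtSum r n)) * (2 * (|ξ₁| * faceWtSum r n)) :=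
    fun α x κ' u' p q a c => abs_conjV_diagK_le (fun p q a c => abs_conjV_diagK_le hMb (hc3 κ' u') p q a c) (hc1 α x) p q a c
  have b12 : ∀ (α : Fin (d + 1)) (x : Site (d + 1)) (κ' : Fin (d + 1)) (u' p q : Site (d + 1)) (a c : Fib d),
      |S₂ α x κ' u' p q a c + conjV (T' κ' u') (diagK fun z b => if blk n (legSite ρ z b) = blk n x then ξ₁ * faceWt r n α x else 0) p q a c|
        ≤ C₂ + BT * (2 * (|ξ₁| * faceWtSum r n)) :=
    fun α x κ' u' p q a c => (abs_add_le _ _).trans (add_le_add (b1 α x κ' u' p q a c) (b2 α x κ' u' p q a c))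
  have b123 : ∀ (α : Fin (d + 1)) (x : Site (d + 1)) (κ' : Fin (d + 1)) (u' p q : Site (d + 1)) (a c : Fib d),
      |S₂ α x κ' u' p q a c + conjV (T' κ' u') (diagK fun z b => if blk n (legSite ρ z b) = blk n x then ξ₁ * faceWt r n α x else 0) p q a c
        + conjV (T α x) (diagK fun z b => if blk n (legSite ρ z b) = blk n u' then ξ₂ * faceWt r n κ' u' else 0) p q a c|
        ≤ (C₂ + BT * (2 * (|ξ₁| * faceWtSum r n))) + BT * (2 * (|ξ₂| * faceWtSum r n)) :=
    fun α x κ' u' p q a c => (abs_add_le _ _).trans (add_le_add (b12 α x κ' u' p q a c) (b3 α x κ' u' p q a c))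
  rw [slotPsiS₂_eq_add_contacts_of_letters' hn r hL hR hT]
  -- split off the four pieces (outermost sum first)
  have e4 : vertex2OfK K n (fun α x κ' u' => S₂ α x κ' u'
        + conjV (T' κ' u') (diagK fun z b => if blk n (legSite ρ z b) = blk n x then ξ₁ * faceWt r n α x else 0)
        + conjV (T α x) (diagK fun z b => if blk n (legSite ρ z b) = blk n u' then ξ₂ * faceWt r n κ' u' else 0)
        + conjV (conjV 𝕄 (diagK fun z b => if blk n (legSite ρ z b) = blk n u' then ξ₃ * faceWt r n κ' u' else 0))
            (diagK fun z b => if blk n (legSite ρ z b) = blk n x then ξ₁ * faceWt r n α x else 0)) μ y ν y'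
      = vertex2OfK K n (fun α x κ' u' => S₂ α x κ' u'
          + conjV (T' κ' u') (diagK fun z b => if blk n (legSite ρ z b) = blk n x then ξ₁ * faceWt r n α x else 0)
          + conjV (T α x) (diagK fun z b => if blk n (legSite ρ z b) = blk n u' then ξ₂ * faceWt r n κ' u' else 0)) μ y ν y'
        + vertex2OfK K n (fun α x κ' u' => conjV (conjV 𝕄 (diagK fun z b => if blk n (legSite ρ z b) = blk n u' then ξ₃ * faceWt r n κ' u' else 0))
            (diagK fun z b => if blk n (legSite ρ z b) = blk n x then ξ₁ * faceWt r n α x else 0)) μ y ν y' :=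
    vertex2OfK_add_of_bdd (N := n) hKex
      (P := fun α x κ' u' => S₂ α x κ' u'
          + conjV (T' κ' u') (diagK fun z b => if blk n (legSite ρ z b) = blk n x then ξ₁ * faceWt r n α x else 0)
          + conjV (T α x) (diagK fun z b => if blk n (legSite ρ z b) = blk n u' then ξ₂ * faceWt r n κ' u' else 0))
      (Q := fun α x κ' u' => conjV (conjV 𝕄 (diagK fun z b => if blk n (legSite ρ z b) = blk n u' then ξ₃ * faceWt r n κ' u' else 0))
            (diagK fun z b => if blk n (legSite ρ z b) = blk n x then ξ₁ * faceWt r n α x else 0))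
      (fun α x κ' u' p q a c => by simpa only [Pi.add_apply] using b123 α x κ' u' p q a c) (fun α x κ' u' p q a c => b4 α x κ' u' p q a c) μ y ν y'
  have e3 : vertex2OfK K n (fun α x κ' u' => S₂ α x κ' u'
          + conjV (T' κ' u') (diagK fun z b => if blk n (legSite ρ z b) = blk n x then ξ₁ * faceWt r n α x else 0)
          + conjV (T α x) (diagK fun z b => if blk n (legSite ρ z b) = blk n u' then ξ₂ * faceWt r n κ' u' else 0)) μ y ν y'
      = vertex2OfK K n (fun α x κ' u' => S₂ α x κ' u'
          + conjV (T' κ' u') (diagK fun z b => if blk n (legSite ρ z b) = blk n x then ξ₁ * faceWt r n α x else 0)) μ y ν y'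
        + vertex2OfK K n (fun α x κ' u' => conjV (T α x) (diagK fun z b => if blk n (legSite ρ z b) = blk n u' then ξ₂ * faceWt r n κ' u' else 0)) μ y ν y' :=
    vertex2OfK_add_of_bdd (N := n) hKex
      (P := fun α x κ' u' => S₂ α x κ' u'
          + conjV (T' κ' u') (diagK fun z b => if blk n (legSite ρ z b) = blk n x then ξ₁ * faceWt r n α x else 0))
      (Q := fun α x κ' u' => conjV (T α x) (diagK fun z b => if blk n (legSite ρ z b) = blk n u' then ξ₂ * faceWt r n κ' u' else 0))
      (fun α x κ' u' p q a c => by simpa only [Pi.add_apply] using b12 α x κ' u' p q a c) (fun α x κ' u' p q a c => b3 α x κ' u' p q a c) μ y ν y'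
  have e2 : vertex2OfK K n (fun α x κ' u' => S₂ α x κ' u'
          + conjV (T' κ' u') (diagK fun z b => if blk n (legSite ρ z b) = blk n x then ξ₁ * faceWt r n α x else 0)) μ y ν y'
      = vertex2OfK K n S₂ μ y ν y'
        + vertex2OfK K n (fun α x κ' u' => conjV (T' κ' u') (diagK fun z b => if blk n (legSite ρ z b) = blk n x then ξ₁ * faceWt r n α x else 0)) μ y ν y' :=
    vertex2OfK_add_of_bdd (N := n) hKex (P := S₂)
      (Q := fun α x κ' u' => conjV (T' κ' u') (diagK fun z b => if blk n (legSite ρ z b) = blk n x then ξ₁ * faceWt r n α x else 0))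
      (fun α x κ' u' p q a c => b1 α x κ' u' p q a c) (fun α x κ' u' p q a c => b2 α x κ' u' p q a c) μ y ν y'
  rw [e4, e3, e2, vertex2OfK_outerContact_eq hn K ρ T' (fun α x => ξ₁ * faceWt r n α x) μ y ν y',
    vertex2OfK_innerContact_eq hn K ρ T (fun κ' u' => ξ₂ * faceWt r n κ' u') μ y ν y',
    vertex2OfK_faceFaceContact_eq hn K ρ 𝕄 (fun α x => ξ₁ * faceWt r n α x) (fun κ' u' => ξ₃ * faceWt r n κ' u') μ y ν y']

variable {r} (hr : r ∈ box (d + 1) n)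
include hr

/-- [folklore] **THE (W-pair) WORD OF THE CHART TRANSPORT AS GAUGE LETTERS**: for an in-block root offset `r`, with `Ψ̂ := psiKS r n`,
`vertex2OfK (Ψ̂∘K∘Ψ̂ᵀ) n S₂ μ y ν y′ = vertex2OfK K n S₂ μ y ν y′ + conjV (V_{T′} ν y′) (Θ₁ μ y) + conjV (V_T μ y) (Θ₂ ν y′) + conjV (conjV 𝕄 (Θ₃ ν y′)) (Θ₁ μ y)`
(TT4 `vertex2OfK_conj_psiKS` + the assembled expansion) — with `T = T′ = S` (a genuine second-partials table) and `Λ := −Θ` the last three terms are the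
`Wmix μ y ν y′ + Wgg μ y ν y′` of `ColumnGaugeInvariance.hessKer_columnGauge` (TT11 §3 `mixed_eq_Wmix`, `faceFace_eq_Wgg`). -/
theorem vertex2OfK_conj_psiKS_eq_add_contacts_of_letters (μ : Fin (d + 1)) (y : Site (d + 1)) (ν : Fin (d + 1)) (y' : Site (d + 1)) :
    vertex2OfK (comp (comp (psiKS r n) K) (trK (psiKS r n))) n S₂ μ y ν y'
      = vertex2OfK K n S₂ μ y ν y'
        + conjV (vertexOfK K n T' ν y')
            (diagK fun z b => ∑ α : Fin (d + 1), ∑ x ∈ blockSitesF n (blk n (legSite ρ z b)), colH K n μ y α x * (ξ₁ * faceWt r n α x))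
        + conjV (vertexOfK K n T μ y)
            (diagK fun z b => ∑ κ' : Fin (d + 1), ∑ u' ∈ blockSitesF n (blk n (legSite ρ z b)), colH K n ν y' κ' u' * (ξ₂ * faceWt r n κ' u'))
        + conjV (conjV 𝕄 (diagK fun z b => ∑ κ' : Fin (d + 1), ∑ u' ∈ blockSitesF n (blk n (legSite ρ z b)), colH K n ν y' κ' u' * (ξ₃ * faceWt r n κ' u')))
            (diagK fun z b => ∑ α : Fin (d + 1), ∑ x ∈ blockSitesF n (blk n (legSite ρ z b)), colH K n μ y α x * (ξ₁ * faceWt r n α x)) := by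
  rw [vertex2OfK_conj_psiKS hn hr hK hS₂ hδ₂ μ y ν y']
  exact vertex2OfK_slotPsiS₂_eq_add_contacts_of_letters hn r hK hS₂ hδ₂ hTb hT'b hMb hL hR hT μ y ν y'

end Assembled

end

end Summit.QuantumFields.BalabanUV.Beta.SymCorrectorPairGaugeVertex
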